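import Summits.BirchSwinnertonDyer.BirchSwinnertonDyer.Theorems.ByReductionTypeAtTwoOrdKatoHalfAtTwoIsoRelaxedMuDoor
import HarnessLib

/-!
# Route ByReductionTypeAtTwo, crux `OrdKatoHalfAtTwoIso` (stmt-BirchSwinnertonDyer-19573), cell [`ρ̄₂` onto ∧ `0 < Δ`]
# (PAIR child 24097, conjunct `OrdKatoHalfAtTwoIsoPosDisc`): the conjunct BY NAME from the RELAXED-AT-∞ road — relaxed Coleman data
# with GENUINE classes + relaxed (A₂) (⟸ Iw⁺ + Lim 2017 Thm 3.5 at `2` upstairs) + Abbes–Ullmo + Kato 17.4 (theorems only)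

Seat `cruxlead-stmt-BirchSwinnertonDyer-19573-w2` GEN 5 (prover WIDTH under the LEAD lineage `cruxlead-19573`; HOME
`run/shared/lean/pub/bsd-2adic/`; pen RC-406 (2) ★ lane «RELAXED-GENUINE»). Sequel of `…OrdKatoHalfAtTwoIsoRelaxedMuDoor` (the per-datum
relaxed `μ`-door and the per-curve door `katoMuPartAtTwo_of_relaxedColeman_irr`). HONEST FRAMING (cell bsd-2adic): BSD is not proved
by any of this; neither the crux nor its `0 < Δ` conjunct is proved here — THEOREMS ONLY, every arithmetic input DISPLAYED as a
hypothesis, nothing asserted. The relaxed data enter as an `∃`-over-Types DOOR (abstract `Xr`); the displayed binder pinning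
`Xr := X^{rel ∞}(W/ℚ_∞)` (`SelmerDualDataRelaxedInf`, Literature typing p703162) is the sequel `…RelaxedGenuineDefs`.

* `ordKatoHalfAtTwoIsoPosDisc_of_relaxedColeman_of_relaxedConjA` — the conjunct BY NAME ⟸ (R) relaxed Coleman data on the cell
  (per datum: SOME `Xr` with package `(θ, P, M, τ, π)`, exponent `e`, GENUINE image clause at `2^e·G₁`, archimedean clause
  `ℓ₍₂₎(X) + e ≤ ℓ₍₂₎(Xr)`) + (Aʳ) relaxed (A₂) on the cell («`ℓ₍₂₎(X₀^{rel ∞}) = 0`») + Abbes–Ullmo + Kato 17.4 (1)(2) at `2`.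
* `relaxedConjATwoPosDisc_of_lim_upstairs_of_classicalMu` — (Aʳ) ⟸ Iw⁺ (`ClassicalMuTwoDivisionFieldAdjoinIOrdPosDisc`) + the named
  fact `Lim2017.thm35_at_two_upstairs_fineSelmer_twoTorsion_finite_of_classicalMuVanishes` + cell bsd-f1-sign2's kernel descent
  (`LimRelUpstairs.lengthAt_relaxed_eq_zero_of_upstairs_two`) — triage r1-2 THEOREM H (H2) in the kernel: the (ε) supply Iw⁺ pays for
  the RELAXED statement (A₂) as well, because upstairs (`ℚ(W[2], μ_{2^∞})`, totally imaginary) there is no real place.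
* `ordKatoHalfAtTwoIsoPosDisc_of_relaxedColeman_of_lim_upstairs_of_classicalMu` — the conjunct BY NAME in the finest currency:
  (R) [memo: Kato 17.11 / 16.6 / (17.13.1) with relaxed-at-`∞` structures + [ASP] 6.9 (i); Kato-witnessed by GENUINE classes, no half
  class] + Iw⁺ [OPEN classical conjecture] + THREE PRINT facts (Lim@2 upstairs, Abbes–Ullmo, Kato 17.4 (1)(2)@2). Compare the (ε)
  door `ordKatoHalfAtTwoIsoPosDisc_of_colemanMu_of_lim_of_classicalMu` (lead g6, p700774): P⁺ (HALF-class package) in place of (R).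

References: [Kato2004Asterisque] Thm 17.4, Prop 17.11, §17.13; reserve [ASP] Thm 6.9 (i)(ii); [GreenbergLNM1716] §4 Lemma 4.6;
[CoatesSujatha2005] (A); [Lim2017FineSelmer] Thm 3.5, Lemma 3.2; [AbbesUllmo1996] Thm A; [Iwasawa1973MuInvariants]; MEMO-7 (1.1)(h);
triage r1-2 GEN 36 §C/§G; tree p700774 (lead g6), p605725 / `…FineRoadLimRelUpstairs` (bsd-f1-sign2).
-/

set_option autoImplicit false
set_option linter.dupNamespace false

noncomputable section

open scoped Classical MatrixGroups ModularForm NumberField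
open CongruenceSubgroup WeierstrassCurve Field IsDedekindDomain NumberField
open Literature.NumberTheory.GaloisRepresentations
open Literature.NumberTheory.GaloisCohomology
open Literature.NumberTheory.EllipticCurves Literature.NumberTheory.EllipticCurves.ModularForms
open Literature.NumberTheory.EllipticCurves.Kato2004
  Literature.NumberTheory.EllipticCurves.Kato2004.EulerSystemValues
open Literature.NumberTheory.EllipticCurves.Rank1Residual
open Literature.NumberTheory.EllipticCurves.Greenberg1999
open Literature.NumberTheory.IwasawaTheory
open Summit.BirchSwinnertonDyer.BirchSwinnertonDyer.Theorems.Rank1ResidualX1Defs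
  Summit.BirchSwinnertonDyer.BirchSwinnertonDyer.Rank1Residual
  Summit.BirchSwinnertonDyer.BirchSwinnertonDyer.Rank1Residual.CoreAssembly
open Summit.BirchSwinnertonDyer.Rank1Residual Summit.BirchSwinnertonDyer.Rank1Residual.X5
  Summit.BirchSwinnertonDyer.Rank1Residual.X1.MuLambda
open Summit.BirchSwinnertonDyer.BirchSwinnertonDyer.Theorems.OrdKatoOptimalAtTwo
  Summit.BirchSwinnertonDyer.BirchSwinnertonDyer.Theorems.OrdKatoIntAtTwo
open Summit.BirchSwinnertonDyer.BirchSwinnertonDyer.Theses.ByReductionTypeAtTwo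
open Summit.BirchSwinnertonDyer.BirchSwinnertonDyer.Theorems.AlignedTransportAtTwoFineRoad

namespace Summit.BirchSwinnertonDyer.BirchSwinnertonDyer.Theorems.SteinbergFibreAtTwo

/-! ## The cell [`ρ̄₂` onto ∧ `0 < Δ`]: the conjunct `OrdKatoHalfAtTwoIsoPosDisc` BY NAME from the relaxed road -/

/-- **The `0 < Δ` conjunct `OrdKatoHalfAtTwoIsoPosDisc` (PAIR child 24097, conjunct 2) BY NAME from the RELAXED road** — inputs,
all DISPLAYED: (R⁺) the relaxed Coleman data on the cell (per curve, newform, cyclotomic datum, `D`, `Yr`: SOME `Xr` with package,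
exponent `e`, image clause at `2^e·G₁`, archimedean clause), (Aʳ) relaxed statement (A₂) on the cell («`ℓ₍₂₎(X₀^{rel ∞}) = 0`»),
Abbes–Ullmo BY NAME and Kato 17.4 (1)(2) at `2` (PRINT). Assembly: §3 at each curve (`ρ̄₂` onto ⇒ `E[2]` irreducible), then
`ord₂ ϖ = 0` (p654400) and `O1.mainConjectureLowerDivisibilityAtTwoOrd_of_katoMuPartAtTwo` with `W′ := W`. CONDITIONAL; nothing
closed; no half class and no Euler-system span clause is used. [cite: Kato2004Asterisque, Thm. 17.4 (1)(2) (p. 273), §17.13]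
[cite: AbbesUllmo1996, Thm. A] [cite: CoatesSujatha2005, Conj. A (shape)] -/
theorem ordKatoHalfAtTwoIsoPosDisc_of_relaxedColeman_of_relaxedConjA
    (hR : ∀ (W : WeierstrassCurve ℚ) [W.IsElliptic] [W.IsGloballyMinimal]
      {N : ℕ} [NeZero N] (f : CuspForm (Gamma0 N) 2) (κ : ZpExtension ℚ 2) (γ : absoluteGaloisGroup ℚ),
      κ.IsCyclotomic → IsOrdinaryAt W 2 → W.HasSurjectiveModNGaloisRep 2 → 0 < W.Δ →
      κ.IsTopGenerator γ → IsCyclotomicVariable 2 γ → IsNewformOf W f →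
      ∀ (D : W.SelmerDualData κ γ) (Yr : W.FineSelmerDualDataRelaxedInf κ γ),
        ∃ (Xr : Type) (_ : AddCommGroup Xr) (_ : Module (IwasawaAlgebra 2) Xr)
          (θ : IwasawaAlgebra 2 ≃+* IwasawaAlgebra 2) (P : Submodule (IwasawaAlgebra 2) (IwasawaAlgebra 2))
          (M : Submodule (IwasawaAlgebra 2) P)
          (τ : P →ₛₗ[(θ : IwasawaAlgebra 2 →+* IwasawaAlgebra 2)] Xr) (π : Xr →ₗ[IwasawaAlgebra 2] Yr.X) (e : ℕ),
          (∀ m ∈ M, τ m = 0) ∧ Function.Surjective π ∧ Function.Exact τ π ∧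
          Module.lengthAt (IwasawaAlgebra 2) D.X
              ⟨IwasawaAlgebra.augIdealP 2, IwasawaAlgebra.isPrime_augIdealP_holds 2⟩ + e ≤
            Module.lengthAt (IwasawaAlgebra 2) Xr ⟨IwasawaAlgebra.augIdealP 2, IwasawaAlgebra.isPrime_augIdealP_holds 2⟩ ∧
          ∀ G₁ : IwasawaAlgebra 2, iwasawaToPowerSeries 2 G₁ = padicLFunction f (unitRoot W 2 : ℚ_[2]) →
            ∃ s : IwasawaAlgebra 2, s ∉ IwasawaAlgebra.augIdealP 2 ∧
              s * (PowerSeries.C (((2 : ℕ) : ℤ_[2]) ^ e) * G₁) ∈ Submodule.map P.subtype M)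
    (hAr : ∀ (W : WeierstrassCurve ℚ) [W.IsElliptic] [W.IsGloballyMinimal], ¬ W.HasCM → W.analyticRank = 0 →
      GoodOrd W 2 → W.HasSurjectiveModNGaloisRep 2 → 0 < W.Δ →
      ∀ (κ : ZpExtension ℚ 2) (γ : absoluteGaloisGroup ℚ), κ.IsCyclotomic → κ.IsTopGenerator γ →
      ∀ Yr : W.FineSelmerDualDataRelaxedInf κ γ,
        Module.lengthAt (IwasawaAlgebra 2) Yr.X ⟨IwasawaAlgebra.augIdealP 2, IwasawaAlgebra.isPrime_augIdealP_holds 2⟩ = 0)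
    (hAU : abbesUllmo_not_dvd_maninConstant_of_not_dvd_level)
    (h17 : ∀ (V : WeierstrassCurve ℚ) [V.IsElliptic] [V.IsGloballyMinimal] [NeZero (V.conductorNorm ℤ)]
      (f : CuspForm (Gamma0 (V.conductorNorm ℤ)) 2), kato_divisibility_allPrimes V 2 (f := f)) :
    OrdKatoHalfAtTwoIsoPosDisc := by
  intro W _ _ hcm hr hgo h2 hΔ
  haveI : NeZero ((2 : ℕ) : ℚ) := ⟨by norm_num⟩
  have hirr : W.HasIrreducibleModPGaloisRep 2 := hasIrreducibleModPGaloisRep_of_hasSurjectiveModNGaloisRep W 2 h2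
  have hμ : O1.KatoMuPartAtTwo W :=
    katoMuPartAtTwo_of_relaxedColeman_irr W hirr
      (fun f κ γ hκ hγ hγ' hf D Yr ↦ hR W f κ γ hκ ⟨hgo.1, hgo.2⟩ h2 hΔ hγ hγ' hf D Yr)
      (fun κ γ hκ hγ Yr ↦ hAr W hcm hr hgo h2 hΔ κ γ hκ hγ Yr)
  exact ⟨W, ‹_›, ‹_›, isIsogenous_self W,
    O1.mainConjectureLowerDivisibilityAtTwoOrd_of_katoMuPartAtTwo W (h17 W)
      (fun f hf ϖ hϖ => hint_two_of_abbesUllmo_of_irr hAU W hgo hirr f hf ϖ hϖ) hμ⟩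

/-- **Relaxed (A₂) on the cell ⟸ Iw⁺ + Lim 2017 Thm. 3.5 at `2` UPSTAIRS (named fact) — triage THEOREM H (H2) in the kernel.** For
every curve of the cell and every cyclotomic `κ`, topological generator `γ` and relaxed fine datum `Yr`: `ℓ₍₂₎(Yr.X) = 0`, from
Iwasawa's `μ₂ = 0` for `ℚ(W[2], √−1)` (Iw⁺ `ClassicalMuTwoDivisionFieldAdjoinIOrdPosDisc`, displayed, OPEN) through the tree's named
fact `Lim2017.thm35_at_two_upstairs_fineSelmer_twoTorsion_finite_of_classicalMuVanishes` (statement (A) UPSTAIRS over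
`ℚ(W[2], μ_{2^∞})`) and cell bsd-f1-sign2's kernel descent `lengthAt_relaxed_eq_zero_of_upstairs_two` (no real place upstairs, so the
descent lands in the RELAXED group downstairs for free). `i := ` a square root of `−1` in `ℚ̄`. CONDITIONAL on Iw⁺ and the named fact.
[cite: Lim2017FineSelmer, §3 Thm. 3.5 and Lemma 3.2] [cite: Iwasawa1973MuInvariants, §1 (shape)] [cite: CoatesSujatha2005, statement (A) (§3)] -/
theorem relaxedConjATwoPosDisc_of_lim_upstairs_of_classicalMu
    (hLim : Lim2017.thm35_at_two_upstairs_fineSelmer_twoTorsion_finite_of_classicalMuVanishes)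
    (hIw : ClassicalMuTwoDivisionFieldAdjoinIOrdPosDisc) :
    ∀ (W : WeierstrassCurve ℚ) [W.IsElliptic] [W.IsGloballyMinimal], ¬ W.HasCM → W.analyticRank = 0 →
      GoodOrd W 2 → W.HasSurjectiveModNGaloisRep 2 → 0 < W.Δ →
      ∀ (κ : ZpExtension ℚ 2) (γ : absoluteGaloisGroup ℚ), κ.IsCyclotomic → κ.IsTopGenerator γ →
      ∀ Yr : W.FineSelmerDualDataRelaxedInf κ γ,
        Module.lengthAt (IwasawaAlgebra 2) Yr.X ⟨IwasawaAlgebra.augIdealP 2, IwasawaAlgebra.isPrime_augIdealP_holds 2⟩ = 0 := by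
  intro W _ _ hcm hr hgo h2 hΔ κ γ hκ hγ Yr
  -- a square root of `−1` in `ℚ̄`
  obtain ⟨i, hi⟩ : ∃ i : AlgebraicClosure ℚ, i ^ 2 = -1 := by
    obtain ⟨i, hi⟩ := IsAlgClosed.exists_pow_nat_eq (-1 : AlgebraicClosure ℚ) (n := 2) (by norm_num)
    exact ⟨i, hi⟩
  exact LimRelUpstairs.lengthAt_relaxed_eq_zero_of_upstairs_two W κ hκ hγ
    (hLim W i hi (hIw W hcm hr hgo h2 hΔ i hi)) Yr

/-- **The `0 < Δ` conjunct BY NAME in the relaxed road's finest currency**: (R⁺) relaxed Coleman data on the cell (memo: Kato 17.11 /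
16.6 / (17.13.1) with the relaxed-at-`∞` structures + [ASP] 6.9 (i); GENUINE classes, no half class), Iw⁺ (Iwasawa's `μ₂ = 0` for
`ℚ(W[2], √−1)`, OPEN classical conjecture) and THREE PRINT facts BY NAME (Lim 2017 Thm 3.5 at `2` upstairs, Abbes–Ullmo, Kato 17.4
(1)(2) at `2`). Compare the (ε) door `ordKatoHalfAtTwoIsoPosDisc_of_colemanMu_of_lim_of_classicalMu` (P⁺ = HALF-class package instead
of R⁺). CONDITIONAL; nothing closed. [cite: Kato2004Asterisque, Thm. 17.4 (1)(2) (p. 273), Prop. 17.11, §17.13] [cite: AbbesUllmo1996, Thm. A]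
[cite: Lim2017FineSelmer, §3 Thm. 3.5] [cite: Iwasawa1973MuInvariants, §1 (shape)] -/
theorem ordKatoHalfAtTwoIsoPosDisc_of_relaxedColeman_of_lim_upstairs_of_classicalMu
    (hR : ∀ (W : WeierstrassCurve ℚ) [W.IsElliptic] [W.IsGloballyMinimal]
      {N : ℕ} [NeZero N] (f : CuspForm (Gamma0 N) 2) (κ : ZpExtension ℚ 2) (γ : absoluteGaloisGroup ℚ),
      κ.IsCyclotomic → IsOrdinaryAt W 2 → W.HasSurjectiveModNGaloisRep 2 → 0 < W.Δ →
      κ.IsTopGenerator γ → IsCyclotomicVariable 2 γ → IsNewformOf W f →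
      ∀ (D : W.SelmerDualData κ γ) (Yr : W.FineSelmerDualDataRelaxedInf κ γ),
        ∃ (Xr : Type) (_ : AddCommGroup Xr) (_ : Module (IwasawaAlgebra 2) Xr)
          (θ : IwasawaAlgebra 2 ≃+* IwasawaAlgebra 2) (P : Submodule (IwasawaAlgebra 2) (IwasawaAlgebra 2))
          (M : Submodule (IwasawaAlgebra 2) P)
          (τ : P →ₛₗ[(θ : IwasawaAlgebra 2 →+* IwasawaAlgebra 2)] Xr) (π : Xr →ₗ[IwasawaAlgebra 2] Yr.X) (e : ℕ),
          (∀ m ∈ M, τ m = 0) ∧ Function.Surjective π ∧ Function.Exact τ π ∧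
          Module.lengthAt (IwasawaAlgebra 2) D.X
              ⟨IwasawaAlgebra.augIdealP 2, IwasawaAlgebra.isPrime_augIdealP_holds 2⟩ + e ≤
            Module.lengthAt (IwasawaAlgebra 2) Xr ⟨IwasawaAlgebra.augIdealP 2, IwasawaAlgebra.isPrime_augIdealP_holds 2⟩ ∧
          ∀ G₁ : IwasawaAlgebra 2, iwasawaToPowerSeries 2 G₁ = padicLFunction f (unitRoot W 2 : ℚ_[2]) →
            ∃ s : IwasawaAlgebra 2, s ∉ IwasawaAlgebra.augIdealP 2 ∧
              s * (PowerSeries.C (((2 : ℕ) : ℤ_[2]) ^ e) * G₁) ∈ Submodule.map P.subtype M)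
    (hLim : Lim2017.thm35_at_two_upstairs_fineSelmer_twoTorsion_finite_of_classicalMuVanishes)
    (hIw : ClassicalMuTwoDivisionFieldAdjoinIOrdPosDisc)
    (hAU : abbesUllmo_not_dvd_maninConstant_of_not_dvd_level)
    (h17 : ∀ (V : WeierstrassCurve ℚ) [V.IsElliptic] [V.IsGloballyMinimal] [NeZero (V.conductorNorm ℤ)]
      (f : CuspForm (Gamma0 (V.conductorNorm ℤ)) 2), kato_divisibility_allPrimes V 2 (f := f)) :
    OrdKatoHalfAtTwoIsoPosDisc :=
  ordKatoHalfAtTwoIsoPosDisc_of_relaxedColeman_of_relaxedConjA hR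
    (relaxedConjATwoPosDisc_of_lim_upstairs_of_classicalMu hLim hIw) hAU h17

end Summit.BirchSwinnertonDyer.BirchSwinnertonDyer.Theorems.SteinbergFibreAtTwo

end
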